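import Mathlib

/-!
# PercRepro — ORBIT-2 (C-021) is not a matroid statement (p2, gen 5)

The three-mark per-orbit inequality ORBIT-2 (C-021: `c₂ ≥ 2·a₁₃` on every interval) can be written in matroid
language: adding two virtual edges `S = {ab, bc}` on the marks to the cycle matroid `M` of `G`, the number of
mark blocks of an edge set `A ⊆ D` is `N(A) = 1 + ρ(A ∪ S) − ρ(A)` (contract `A`; the virtual path then spans
`N(A)` distinct vertices).  So ORBIT-2 is the instance, for the graphic matroid `M` on `D ⊔ S` with `ρ(S) = 2`, of

  `#{A ⊆ D : ρ(A ∪ S) = ρ(A) + 1}  ≥  2 · #{A ⊆ D : ρ(A ∪ S) = ρ(A) ∧ ρ((D ∖ A) ∪ S) = ρ(D ∖ A) + 2}`.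

This file records that the matroid statement is FALSE in general: for the uniform matroid `U_{3,6}` and any two
elements `S`, the right side counts the `5` subsets of `D` with at least three elements and the left side the
`6` two-element subsets.  Hence ORBIT-2 (and with it C-022 / C-023 with unmarked vertices) is not a consequence
of the rank / closure axioms — unlike the all-marked rows, which are instances of C-025 — and every proof must use
the vertices and paths of the graph.

* `Orbit2Matroid` — the matroid form (Mathlib `Matroid α`, `[M.Finite]`, `M.eRk`, counts by `Set.ncard`, the
  spelling of `C025`);
* `unif36` — `U_{3,6}` on `Fin 6` from the independence axioms (`IndepMatroid.ofFinite`);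
* `not_orbit2Matroid : ¬ Orbit2Matroid`.
-/

namespace PercRepro

open Set

/-- **The matroid form of ORBIT-2 (C-021)**: for every finite matroid `M` and every `S ⊆ M.E` of rank `2`
(the virtual edges on the three marks; `D := M.E ∖ S`), with `ρ = M.eRk`,
`2 · #{A ⊆ D : ρ(A ∪ S) = ρ(A), ρ((D ∖ A) ∪ S) = ρ(D ∖ A) + 2} ≤ #{A ⊆ D : ρ(A ∪ S) = ρ(A) + 1}`.
On the cycle matroid of a graph with `S = {ab, bc}` this is exactly C-021 (`N(A) = 1 + ρ(A ∪ S) − ρ(A)`);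
the statement is FALSE for matroids in general (`not_orbit2Matroid`). -/
def Orbit2Matroid : Prop :=
  ∀ {α : Type} (M : Matroid α) [M.Finite] (S : Set α), S ⊆ M.E → M.eRk S = 2 →
    2 * ({A : Set α | A ⊆ M.E \ S ∧ M.eRk (A ∪ S) = M.eRk A ∧
            M.eRk ((M.E \ S) \ A ∪ S) = M.eRk ((M.E \ S) \ A) + 2}.ncard : ℚ) ≤
      ({A : Set α | A ⊆ M.E \ S ∧ M.eRk (A ∪ S) = M.eRk A + 1}.ncard : ℚ)

/-- `U_{3,6}`: the uniform matroid of rank `3` on `Fin 6` — independent sets = sets with at most three elements. -/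
def unif36 : Matroid (Fin 6) :=
  (IndepMatroid.ofFinite (E := (univ : Set (Fin 6))) finite_univ (fun I => I.ncard ≤ 3)
    (by simp)
    (fun I J hJ hIJ => (ncard_le_ncard hIJ).trans hJ)
    (fun I J hI hJ hlt => by
      obtain ⟨e, heJ, heI⟩ : ∃ e ∈ J, e ∉ I := by
        by_contra h
        push Not at h
        exact absurd (ncard_le_ncard h) (not_le.mpr hlt)
      refine ⟨e, heJ, heI, ?_⟩
      rw [ncard_insert_of_notMem heI]
      omega)
    (fun I _ => subset_univ I)).matroid

/-- Independence in `U_{3,6}`. -/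
theorem unif36_indep_iff (I : Set (Fin 6)) : unif36.Indep I ↔ I.ncard ≤ 3 := by
  simp [unif36]

/-- The rank of a set with at most three elements is its size. -/
theorem unif36_eRk_of_le {X : Set (Fin 6)} (hX : X.ncard ≤ 3) : unif36.eRk X = X.ncard := by
  rw [((unif36_indep_iff X).2 hX).eRk_eq_encard, (toFinite X).cast_ncard_eq]

/-- The rank of a set with at least three elements is `3`. -/
theorem unif36_eRk_of_ge {X : Set (Fin 6)} (hX : 3 ≤ X.ncard) : unif36.eRk X = 3 := by
  apply le_antisymm
  · rw [Matroid.eRk_le_iff]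
    intro I _ hI
    rw [unif36_indep_iff] at hI
    rw [← (toFinite I).cast_ncard_eq]
    exact_mod_cast hI
  · have hX' : (3 : ℕ∞) ≤ X.encard := by
      rw [← (toFinite X).cast_ncard_eq]
      exact_mod_cast hX
    obtain ⟨I, hIX, hI⟩ := exists_subset_encard_eq hX'
    have hI' : I.ncard = 3 := by
      have := (toFinite I).cast_ncard_eq
      rw [hI] at this
      exact_mod_cast this
    rw [Matroid.le_eRk_iff]
    exact ⟨I, hIX, (unif36_indep_iff I).2 hI'.le, hI⟩


/-- The virtual set `S = {0, 1}` of `U_{3,6}`. -/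
def S36 : Set (Fin 6) := {0, 1}

/-- `D = E ∖ S = {2, 3, 4, 5}` as a finset. -/
def D36 : Finset (Fin 6) := {2, 3, 4, 5}

/-- `|S| = 2`. -/
theorem S36_ncard : S36.ncard = 2 := by
  rw [S36, ncard_pair (by decide)]

/-- `E ∖ S = D` for `U_{3,6}` (`E = univ`). -/
theorem univ_sdiff_S36 : (univ : Set (Fin 6)) \ S36 = (D36 : Set (Fin 6)) := by
  ext x
  simp only [S36, D36, mem_sdiff, mem_univ, true_and, mem_insert_iff, mem_singleton_iff,
    Finset.coe_insert, Finset.coe_singleton]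
  fin_cases x <;> simp

/-- The counting set-families as images of finset families (so that `Set.ncard` becomes `Finset.card`). -/
theorem setOf_eq_image (P : ℕ → Prop) [DecidablePred P] :
    {A : Set (Fin 6) | A ⊆ (D36 : Set (Fin 6)) ∧ P A.ncard} =
      (fun B : Finset (Fin 6) => (B : Set (Fin 6))) '' ↑(D36.powerset.filter (fun B => P B.card)) := by
  ext A
  constructor
  · rintro ⟨hA, hP⟩
    refine ⟨(toFinite A).toFinset, ?_, (toFinite A).coe_toFinset⟩
    simp only [Finset.mem_coe, Finset.mem_filter, Finset.mem_powerset]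
    refine ⟨?_, ?_⟩
    · rw [← Finset.coe_subset, (toFinite A).coe_toFinset]; exact hA
    · rwa [← ncard_eq_toFinset_card A (toFinite A)]
  · rintro ⟨B, hB, rfl⟩
    simp only [Finset.mem_coe, Finset.mem_filter, Finset.mem_powerset] at hB
    exact ⟨Finset.coe_subset.2 hB.1, by rw [ncard_coe_finset]; exact hB.2⟩

/-- `Set.ncard` of a family `{A ⊆ D | P |A|}` of subsets of `Fin 6` as a `Finset.card` (decidable). -/
theorem ncard_setOf (P : ℕ → Prop) [DecidablePred P] :
    {A : Set (Fin 6) | A ⊆ (D36 : Set (Fin 6)) ∧ P A.ncard}.ncard =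
      (D36.powerset.filter (fun B => P B.card)).card := by
  rw [setOf_eq_image, ncard_image_of_injective _ Finset.coe_injective, ncard_coe_finset]


/-- `unif36` in closed form: the rank of `X` is `min 3 |X|`. -/
theorem unif36_eRk_eq (X : Set (Fin 6)) : unif36.eRk X = ((min 3 X.ncard : ℕ) : ℕ∞) := by
  rcases le_or_gt X.ncard 3 with h | h
  · rw [unif36_eRk_of_le h, min_eq_right h]
  · rw [unif36_eRk_of_ge h.le, min_eq_left h.le]; rfl

/-- For `A ⊆ D`, `|A ∪ S| = |A| + 2`. -/
theorem ncard_union_S36 {A : Set (Fin 6)} (hA : A ⊆ (D36 : Set (Fin 6))) :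
    (A ∪ S36).ncard = A.ncard + 2 := by
  rw [ncard_union_eq _ (toFinite A) (toFinite S36), S36_ncard]
  rw [← univ_sdiff_S36] at hA
  exact disjoint_sdiff_left.mono_left hA

/-- For `A ⊆ D`, `|A| ≤ 4`. -/
theorem ncard_le_four {A : Set (Fin 6)} (hA : A ⊆ (D36 : Set (Fin 6))) : A.ncard ≤ 4 := by
  have := ncard_le_ncard hA (toFinite _)
  rwa [ncard_coe_finset, show D36.card = 4 by decide] at this

/-- For `A ⊆ D`, `|D ∖ A| = 4 − |A|`. -/
theorem ncard_D36_sdiff {A : Set (Fin 6)} (hA : A ⊆ (D36 : Set (Fin 6))) :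
    ((D36 : Set (Fin 6)) \ A).ncard = 4 - A.ncard := by
  rw [ncard_sdiff hA (toFinite _), ncard_coe_finset, show D36.card = 4 by decide]

/-- In `U_{3,6}` with `S = {0, 1}`, the «good antipodal pair» condition of `Orbit2Matroid` holds for
`A ⊆ D` iff `|A| ≥ 3`. -/
theorem mem_U_iff {A : Set (Fin 6)} (hA : A ⊆ (D36 : Set (Fin 6))) :
    (unif36.eRk (A ∪ S36) = unif36.eRk A ∧
      unif36.eRk ((D36 : Set (Fin 6)) \ A ∪ S36) = unif36.eRk ((D36 : Set (Fin 6)) \ A) + 2) ↔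
      3 ≤ A.ncard := by
  have h1 := ncard_union_S36 hA
  have h2 := ncard_union_S36 (sdiff_subset : ((D36 : Set (Fin 6)) \ A) ⊆ (D36 : Set (Fin 6)))
  have h3 := ncard_D36_sdiff hA
  have h4 := ncard_le_four hA
  simp only [unif36_eRk_eq, h1, h2, h3]
  constructor
  · rintro ⟨e1, -⟩
    have e1' : min 3 (A.ncard + 2) = min 3 A.ncard := by exact_mod_cast e1
    omega
  · intro h
    constructor
    · exact_mod_cast (show min 3 (A.ncard + 2) = min 3 A.ncard by omega)
    · exact_mod_cast (show min 3 (4 - A.ncard + 2) = min 3 (4 - A.ncard) + 2 by omega)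

/-- In `U_{3,6}` with `S = {0, 1}`, the «level-2» condition of `Orbit2Matroid` holds for `A ⊆ D` iff
`|A| = 2`. -/
theorem mem_Y_iff {A : Set (Fin 6)} (hA : A ⊆ (D36 : Set (Fin 6))) :
    unif36.eRk (A ∪ S36) = unif36.eRk A + 1 ↔ A.ncard = 2 := by
  have h1 := ncard_union_S36 hA
  have h4 := ncard_le_four hA
  simp only [unif36_eRk_eq, h1]
  constructor
  · intro e
    have e' : min 3 (A.ncard + 2) = min 3 A.ncard + 1 := by exact_mod_cast e
    omega
  · intro h
    exact_mod_cast (show min 3 (A.ncard + 2) = min 3 A.ncard + 1 by omega)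

/-- **ORBIT-2 is not a matroid statement**: the matroid form `Orbit2Matroid` fails for `U_{3,6}` with
`S = {0, 1}` — the good antipodal pairs are the `5` subsets of `D = {2, 3, 4, 5}` with at least three
elements, the level-2 sets are the `6` two-element subsets, and `2 · 5 > 6`. -/
theorem not_orbit2Matroid : ¬ Orbit2Matroid := by
  intro h
  have hr : unif36.eRk S36 = 2 := by
    rw [unif36_eRk_of_le (by rw [S36_ncard]; norm_num), S36_ncard]; rfl
  have key := h unif36 S36 (subset_univ _) hr
  have hE : unif36.E = univ := rfl
  simp only [hE, univ_sdiff_S36] at key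
  have hU : {A : Set (Fin 6) | A ⊆ (D36 : Set (Fin 6)) ∧ unif36.eRk (A ∪ S36) = unif36.eRk A ∧
      unif36.eRk ((D36 : Set (Fin 6)) \ A ∪ S36) = unif36.eRk ((D36 : Set (Fin 6)) \ A) + 2} =
      {A : Set (Fin 6) | A ⊆ (D36 : Set (Fin 6)) ∧ 3 ≤ A.ncard} := by
    ext A
    simp only [mem_setOf_eq]
    exact and_congr_right fun hA => mem_U_iff hA
  have hY : {A : Set (Fin 6) | A ⊆ (D36 : Set (Fin 6)) ∧ unif36.eRk (A ∪ S36) = unif36.eRk A + 1} =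
      {A : Set (Fin 6) | A ⊆ (D36 : Set (Fin 6)) ∧ A.ncard = 2} := by
    ext A
    simp only [mem_setOf_eq]
    exact and_congr_right fun hA => mem_Y_iff hA
  rw [hU, hY, ncard_setOf (fun n => 3 ≤ n), ncard_setOf (fun n => n = 2)] at key
  have c1 : (D36.powerset.filter (fun B => 3 ≤ B.card)).card = 5 := by decide
  have c2 : (D36.powerset.filter (fun B => B.card = 2)).card = 6 := by decide
  rw [c1, c2] at key
  norm_num at key

end PercRepro
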